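import Summits.HodgeConjecture.HodgeCM.Proofs.Pohlmann.GaoUllmoDictionary_1

/-! PORT of `HodgeCM/Proofs/Pohlmann/GaoUllmoDictionary.lean` (HodgeCMPerL run 82) — part 2: continuation of `Summits.HodgeConjecture.HodgeCM.Proofs.Pohlmann.GaoUllmoDictionary_1` (split at a top-level declaration boundary by port_pkg.py; scope re-opened below; declarations unchanged). -/

-- port_pkg: scope re-opened for this part (file-level context, then the namespace/section stack open at the cut)
noncomputable section
open scoped BigOperators
namespace HodgeCM
namespace GaoUllmo
open Literature.AlgebraicGeometry.Motives (CMType)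
open HodgeCM.CMTypeOps
attribute [local instance] Classical.propDecidable
section PiDictionary
variable {F : Type} [Field F] {n : ℕ}
variable [NumberField F]
variable (n)
variable {n}
section Count
/-- (Ported verbatim from the HodgeCMPerL package; no docstring in the source.) -/
theorem card_galActSet_inter_bar (σ : galoisClosure (Fin (n + 1) → F) ≃ₐ[ℚ] galoisClosure (Fin (n + 1) → F))
    (Φ : CMTypeOn (Fin (n + 1) → F)) (P : Finset (Emb (Fin (n + 1) → F))) :
    (galActSet (Fin (n + 1) → F) σ P ∩ Φ.bar).card + (galActSet (Fin (n + 1) → F) σ P ∩ Φ.Φ).card = P.card := by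
  have h1 : galActSet (Fin (n + 1) → F) σ P ∩ Φ.bar = galActSet (Fin (n + 1) → F) σ P \ Φ.Φ := by
    ext φ
    rw [Finset.mem_inter, Finset.mem_sdiff, CMTypeOn.mem_bar_iff]
  rw [h1, Finset.card_sdiff_add_card_inter]
  exact Finset.card_image_of_injective _ (galAct_injective σ)

end Count

/-! ### The dictionary theorem -/

section Main

/-- One direction needs no hypothesis on `F`: a Hodge weight gives a set satisfying (3.2). -/
theorem satisfiesEq32_of_isHodgeWeight (Θ : Fin (n + 1) → CMType F) (p : ℕ) (S : Fin (n + 1) → Finset (F →+* ℂ))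
    (hS : IsHodgeWeight Θ p S) : (embSet S).card = 2 * p ∧ SatisfiesEq32 (piCMType Θ) (embSet S) := by
  have hcard : (embSet S).card = 2 * p := by rw [card_embSet]; exact hS.1
  refine ⟨hcard, fun σ => ?_⟩
  have hsum := card_galActSet_inter_bar σ (piCMType Θ) (embSet S)
  rw [card_galActSet_embSet_inter] at hsum ⊢
  rw [hcard] at hsum
  have hc : (typeCount Θ S (galF n σ) : ℤ) = p := by
    rw [← sum_ind_eq_typeCount]
    exact hS.2 (galTOf σ)
  have hc' : typeCount Θ S (galF n σ) = p := by exact_mod_cast hc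
  omega

/-- **The dictionary** (`F` Galois): the package's Hodge-weight condition `IsHodgeWeight Θ p S` IS Gao–Ullmo's
condition (3.2) for the set `P_S ⊆ Hom(F^{n+1}, ℂ)` and the CM type `Φ_Θ = ⊔_j Θ_j`, together with `|P_S| = 2p`. -/
theorem isHodgeWeight_iff_satisfiesEq32 [IsGalois ℚ F] (Θ : Fin (n + 1) → CMType F) (p : ℕ)
    (S : Fin (n + 1) → Finset (F →+* ℂ)) :
    IsHodgeWeight Θ p S ↔ (embSet S).card = 2 * p ∧ SatisfiesEq32 (piCMType Θ) (embSet S) := by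
  refine ⟨satisfiesEq32_of_isHodgeWeight Θ p S, fun ⟨hcard, h32⟩ => ⟨by rwa [card_embSet] at hcard, fun P => ?_⟩⟩
  obtain ⟨σ, rfl⟩ := galTOf_surjective (n := n) P
  have hP : ⇑(galTOf (n := n) σ).1 = galF n σ := rfl
  rw [hP, sum_ind_eq_typeCount]
  have hsum := card_galActSet_inter_bar σ (piCMType Θ) (embSet S)
  have h := h32 σ
  rw [card_galActSet_embSet_inter] at hsum h
  rw [hcard] at hsum
  have : typeCount Θ S (galF n σ) = p := by omega
  exact_mod_cast this

/-- The bijection of index sets: package Hodge weights `↔` Gao–Ullmo's sets `P ⊆ Hom(E, ℂ)`, `|P| = 2p`, with (3.2). -/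
def hodgeWeightEquiv [IsGalois ℚ F] (Θ : Fin (n + 1) → CMType F) (p : ℕ) :
    {S : Fin (n + 1) → Finset (F →+* ℂ) // IsHodgeWeight Θ p S} ≃
      {P : Set.powersetCard (Emb (Fin (n + 1) → F)) (2 * p) //
        SatisfiesEq32 (piCMType Θ) (P : Finset (Emb (Fin (n + 1) → F)))} where
  toFun S := ⟨⟨embSet S.1, (satisfiesEq32_of_isHodgeWeight Θ p S.1 S.2).1⟩,
    (satisfiesEq32_of_isHodgeWeight Θ p S.1 S.2).2⟩
  invFun P := ⟨weightOfSet (P.1 : Finset (Emb (Fin (n + 1) → F))), by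
    rw [isHodgeWeight_iff_satisfiesEq32, embSet_weightOfSet]
    exact ⟨P.1.2, P.2⟩⟩
  left_inv S := by
    apply Subtype.ext
    exact weightOfSet_embSet S.1
  right_inv P := by
    apply Subtype.ext
    apply Subtype.ext
    exact embSet_weightOfSet (P.1 : Finset (Emb (Fin (n + 1) → F)))

/-- The two counts agree: `#{S // IsHodgeWeight Θ p S} = #{P ⊆ Hom(F^{n+1}, ℂ) : |P| = 2p, (3.2)}`. -/
theorem card_hodgeWeight_eq [IsGalois ℚ F] (Θ : Fin (n + 1) → CMType F) (p : ℕ) :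
    Nat.card {S : Fin (n + 1) → Finset (F →+* ℂ) // IsHodgeWeight Θ p S} =
      Nat.card {P : Set.powersetCard (Emb (Fin (n + 1) → F)) (2 * p) //
        SatisfiesEq32 (piCMType Θ) (P : Finset (Emb (Fin (n + 1) → F)))} :=
  Nat.card_congr (hodgeWeightEquiv Θ p)

/-- **Gao–Ullmo Thm 3.1 "In particular", read in package vocabulary** (kernel, from `Theorem31_finrank_holds`): for `F` a Galois
CM field, in Gao–Ullmo's model of `A_{(F^{n+1}, ⊔_j Θ_j)} = ∏_j A_{(F, Θ_j)}` the dimension of the space of Hodge classes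
`B^p` is the number of the package's Hodge weights `S` (`IsHodgeWeight Θ p S`). -/
theorem finrank_Bp_pi_eq_card_hodgeWeight [NumberField.IsCMField F] [IsGalois ℚ F]
    [LinearOrder (Emb (Fin (n + 1) → F))] (Θ : Fin (n + 1) → CMType F) (hord : OrderConvention (piCMType Θ)) (p : ℕ) :
    Module.finrank ℚ (Bp (piCMType Θ) p) = Nat.card {S : Fin (n + 1) → Finset (F →+* ℂ) // IsHodgeWeight Θ p S} := by
  rw [Theorem31_finrank_holds (Fin (n + 1) → F) (isCMAlgebra_pi (Fin (n + 1)) F) (piCMType Θ) hord p,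
    card_hodgeWeight_eq]

/-- **Gao–Ullmo Thm 3.1, read in package vocabulary** (kernel, from `Theorem31_holds`): `B^p ⊗ ℂ` of Gao–Ullmo's model of
`∏_j A_{(F, Θ_j)}` is the span of the `[P_S]`, `S` a Hodge weight of the package. -/
theorem span_Bp_pi_eq_span_wedge_hodgeWeight [NumberField.IsCMField F] [IsGalois ℚ F]
    [LinearOrder (Emb (Fin (n + 1) → F))] (Θ : Fin (n + 1) → CMType F) (hord : OrderConvention (piCMType Θ)) (p : ℕ) :
    Submodule.span ℂ (Bp (piCMType Θ) p : Set (Hr (Fin (n + 1) → F) (2 * p))) =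
      Submodule.span ℂ {x | ∃ S : {S : Fin (n + 1) → Finset (F →+* ℂ) // IsHodgeWeight Θ p S},
        x = wedge (Fin (n + 1) → F) (2 * p) (hodgeWeightEquiv Θ p S).1} := by
  rw [Theorem31_holds (Fin (n + 1) → F) (isCMAlgebra_pi (Fin (n + 1)) F) (piCMType Θ) hord p]
  congr 1
  ext x
  simp only [Set.mem_setOf_eq]
  constructor
  · rintro ⟨P, hP, rfl⟩
    refine ⟨(hodgeWeightEquiv Θ p).symm ⟨P, hP⟩, ?_⟩
    rw [Equiv.apply_symm_apply]
  · rintro ⟨S, rfl⟩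
    exact ⟨(hodgeWeightEquiv Θ p S).1, (hodgeWeightEquiv Θ p S).2, rfl⟩

end Main

end PiDictionary

end GaoUllmo

end HodgeCM

-- port_pkg: scope closed for this part
end
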